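import Summits.CriticalPhenomena.PercolationContinuityZ3.Theorems.PercShatteringRaceNearLinearTwoClusterDecayStubAspectOfTwoArmBdry
import HarnessLib

/-!
# Crux `PercShatteringRace.NearLinearTwoClusterDecay` (stmt-CriticalPhenomena-5785) — stub F1 `stub_pairAspectOfTwoArm`

Helper file of the line `pair-decay-long-arms-dense` (§ Unconditional frontier, child 1 in PAIR
form); lands with `--supports stmt-CriticalPhenomena-5785` (registered frontier stub
`stub_pairAspectOfTwoArm`).

## Statement

Bond percolation on `ℤ³` at a general parameter `p > 0`: a pair-connection lower bound
`P_p(a ↔ b inside Λ_{2n}) ≥ c n^{-e}` on `Λ_n²` (`n ≥ 1`, `e ≥ 0`) and a two-arms exponent `κ > 0`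
(`P_p(edgeTwoArms i m) ≤ C m^{-κ}`, `m ≥ 1`) give, for every aspect exponent `A > 1` with
`κ A > 6 + e` and every `ε > 0`, that eventually in `n`, UNIFORMLY over the pair `x, x' ∈ Λ_n`, the
pair event — `x` and `x'` each joined inside `Λ_N` to `∂ⁱⁿΛ_N` but not to each other inside `Λ_N`,
`N = ⌈n^A⌉` — has probability at most `ε`.  Compared with the union form (W5,
`stub_aspectOfTwoArmBdry`, exponent `10 + e`) there is no sum over pairs of `∂ⁱⁿΛ_n`, whence the
exponent `6 + e`.

## Proof sketch

Write `N = ⌈n^A⌉₊`, `P = P_p`.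
* For configurations on lattice edges and a FIXED pair `x, x' ∈ Λ_n`, the pair event of
  `(Λ_n, Λ_{n+ℓ})` lies in `twoArmsBox n ℓ x x'` (`mem_twoArmsBox_of_pair`): inside `Λ_{n+ℓ}` the
  open clusters are the reachability classes of `openGraph ω ⊓ withinGraph ℤ^d Λ_{n+ℓ}`, so the
  clusters of `x, x'` are distinct and both reach `∂ⁱⁿΛ_{n+ℓ}`.
* Cerf 2015 Lemma 7.1 (bond, `AKN.real_twoArmsBox_mul_le`) with middle box `Λ_{2n}`, divided by
  `δ = c n^{-e}` (`real_pair_le_of_conn`), and counted (`real_pair_le_poly`: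
  `|Λ_{2n+1}| = (4n+3)³`, `|E(Λ_{2n+1})| ≤ 6 |Λ_{2n+1}|`, three directions):
  `P(pair event) ≤ (1 + 6/p) (4n+3)⁶ · 3C (N − 2n − 2)^{−κ} / (c n^{−e})` once `2n + 3 ≤ N`.
* Real analysis (`poly_bound_pair`, `collect_rpow_pair`; eventually `16 n ≤ n^A` by W3's
  `NearLinearTwoClusterDecayCritAspect.eventually_one_le_and_sixteen_mul_le`, whence
  `2n + 3 ≤ N`, `N − 2n − 2 ≥ n^A / 2`): the bound is `≤ K n^{6 + e − κA} → 0` as `κA > 6 + e`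
  (`tendsto_rpow_neg_atTop`), so it is eventually `< ε`.

## References

* R. Cerf, *A lower bound on the two-arms exponent for critical percolation on the lattice*, Ann. Probab. 43
  (2015), §7, Lemma 7.1 and Corollary 7.2 (arXiv:1306.3105 pp. 11–13) [Cerf2015].
-/

noncomputable section

namespace Summit.CriticalPhenomena.PercolationContinuityZ3.Theorems

namespace NearLinearTwoClusterDecayPairAspect

open MeasureTheory Filter Topology
open Literature.Probability.LatticeModels Literature.Probability.Percolation

variable {d : ℕ}

/-! ## The pair event sits inside Cerf's two-arms event -/

/-- **The pair event through `twoArmsBox`** (Cerf 2015, Cor. 7.2, for a FIXED pair): for a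
configuration on lattice edges, if `x, x' ∈ Λ_n` are joined inside `Λ_{n+ℓ}` to `∂ⁱⁿΛ_{n+ℓ}` but not
to each other, then `twoArmsBox n ℓ x x'` occurs (clusters inside `Λ_{n+ℓ}` are reachability classes
of `openGraph ω ⊓ withinGraph ℤ^d Λ_{n+ℓ}`). [cite: Cerf2015, Cor 7.2] -/
theorem mem_twoArmsBox_of_pair {n ℓ : ℕ} {ω : BondConfig (Site d)} (hω : ω ⊆ (zdGraph d).edgeSet)
    {x x' y y' : Site d} (hx : x ∈ box d n) (hx' : x' ∈ box d n)
    (hy : y ∈ innerBoundary (zdGraph d) (box d (n + ℓ)))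
    (hy' : y' ∈ innerBoundary (zdGraph d) (box d (n + ℓ)))
    (hxy : ω ∈ openConnIn ↑(box d (n + ℓ)) x y) (hx'y' : ω ∈ openConnIn ↑(box d (n + ℓ)) x' y')
    (hxx' : ω ∉ openConnIn ↑(box d (n + ℓ)) x x') :
    ω ∈ AKN.twoArmsBox n ℓ x x' := by
  have hsub : box d n ⊆ box d (n + ℓ) := box_mono d (Nat.le_add_right n ℓ)
  -- `openConnIn` (tree) is reachability in `openGraph ω ⊓ withinGraph ℤ^d Λ_{n+ℓ}` for `ω ⊆ E(ℤ^d)`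
  have key : ∀ {a b : Site d}, a ∈ box d (n + ℓ) → (ω ∈ openConnIn ↑(box d (n + ℓ)) a b ↔
      (openGraph ω ⊓ withinGraph (zdGraph d) ↑(box d (n + ℓ))).Reachable a b) := by
    intro a b ha
    rw [openConnIn_eq_openConnVia (Finset.mem_coe.2 ha), ← mem_openClusterIn_iff,
      openClusterIn_withinGraph_eq_top (zdGraph d) _ hω]
    exact Iff.rfl
  have hxyR := (key (hsub hx)).1 hxy
  have hx'y'R := (key (hsub hx')).1 hx'y'
  simp only [AKN.twoArmsBox, AKN.Reaches, Set.mem_setOf_eq, mem_openClusterIn_iff]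
  exact ⟨fun hab => hxx' ((key (hsub hx)).2 hab), ⟨y, hy, hxyR⟩, ⟨y', hy', hx'y'R⟩⟩

/-! ## Lemma 7.1 for the pair, and the count -/

/-- **Cerf 2015, Lemma 7.1 (bond) for a fixed pair, divided by a pair-connection lower bound.**
For `k + 3 ≤ ℓ`, `p > 0`, `x, x' ∈ Λ_n` and `δ > 0` with `δ ≤ P_p(x ↔ x' inside Λ_{n+k})`: the pair
event of `(Λ_n, Λ_{n+ℓ})` at `x, x'` has probability at most
`(1 + |E(Λ_{n+k+1})|/p) |Λ_{n+k+1}| (Σ_i P_p(edgeTwoArms i (ℓ−k−2))) / δ`.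
[cite: Cerf2015, Lemma 7.1] -/
theorem real_pair_le_of_conn (p : unitInterval) (hp0 : 0 < (p : ℝ)) {n k ℓ : ℕ}
    (hkℓ : k + 3 ≤ ℓ) {δ : ℝ} (hδ : 0 < δ) {x x' : Site d} (hx : x ∈ box d n)
    (hx' : x' ∈ box d n)
    (hq : δ ≤ (bondPercolation (zdGraph d) p).real
      (openConnIn (↑(box d (n + k)) : Set (Site d)) x x')) :
    (bondPercolation (zdGraph d) p).real
      {ω | ∃ y ∈ innerBoundary (zdGraph d) (box d (n + ℓ)),
        ∃ y' ∈ innerBoundary (zdGraph d) (box d (n + ℓ)),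
          ω ∈ openConnIn ↑(box d (n + ℓ)) x y ∧ ω ∈ openConnIn ↑(box d (n + ℓ)) x' y' ∧
          ω ∉ openConnIn ↑(box d (n + ℓ)) x x'} ≤
      ((1 + (edgesIn (zdGraph d) (box d (n + k + 1))).card / p) *
        ((box d (n + k + 1)).card *
          ∑ i : Fin d, (bondPercolation (zdGraph d) p).real (AKN.edgeTwoArms i (ℓ - k - 2)))) / δ := by
  set μ := bondPercolation (zdGraph d) p with hμ
  have hvia : δ ≤ μ.real
      (openConnVia (withinGraph (zdGraph d) (↑(box d (n + k)) : Set (Site d))) x x') := by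
    refine hq.trans (DCT16.real_mono_of_forall_subset_edgeSet (zdGraph d) p fun ω hω h => ?_)
    have hxk : x ∈ (↑(box d (n + k)) : Set (Site d)) :=
      Finset.mem_coe.2 (box_mono d (Nat.le_add_right n k) hx)
    rw [openConnIn_eq_openConnVia hxk] at h
    rw [openConnVia, Set.mem_setOf_eq, openClusterIn_withinGraph_eq_top (zdGraph d) _ hω]
    exact h
  have hT : μ.real
      {ω | ∃ y ∈ innerBoundary (zdGraph d) (box d (n + ℓ)),
        ∃ y' ∈ innerBoundary (zdGraph d) (box d (n + ℓ)),
          ω ∈ openConnIn ↑(box d (n + ℓ)) x y ∧ ω ∈ openConnIn ↑(box d (n + ℓ)) x' y' ∧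
          ω ∉ openConnIn ↑(box d (n + ℓ)) x x'} ≤ μ.real (AKN.twoArmsBox n ℓ x x') := by
    refine DCT16.real_mono_of_forall_subset_edgeSet (zdGraph d) p fun ω hω h => ?_
    obtain ⟨y, hy, y', hy', hxy, hx'y', hxx'⟩ := h
    exact mem_twoArmsBox_of_pair hω hx hx' hy hy' hxy hx'y' hxx'
  have h71 := AKN.real_twoArmsBox_mul_le p hp0 (n := n) (k := k) hkℓ hx hx'
  rw [le_div_iff₀ hδ]
  calc μ.real
        {ω | ∃ y ∈ innerBoundary (zdGraph d) (box d (n + ℓ)),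
          ∃ y' ∈ innerBoundary (zdGraph d) (box d (n + ℓ)),
            ω ∈ openConnIn ↑(box d (n + ℓ)) x y ∧ ω ∈ openConnIn ↑(box d (n + ℓ)) x' y' ∧
            ω ∉ openConnIn ↑(box d (n + ℓ)) x x'} * δ
      ≤ μ.real (AKN.twoArmsBox n ℓ x x') *
          μ.real (openConnVia (withinGraph (zdGraph d) (↑(box d (n + k)) : Set (Site d))) x x') :=
        mul_le_mul hT hvia hδ.le measureReal_nonneg
    _ ≤ _ := h71

/-- **The counted form on `ℤ³` for a fixed pair.** With a two-arms exponent `κ`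
(`P_p(edgeTwoArms i m) ≤ C m^{-κ}`, `m ≥ 1`), `n ≤ m`, `m + 3 ≤ M`, `x, x' ∈ Λ_n` and
`δ ≤ P_p(x ↔ x' inside Λ_m)`: the pair event of `(Λ_n, Λ_M)` at `x, x'` has probability at most
`(1 + 6/p) (2m+3)⁶ · 3C (M−m−2)^{−κ} / δ` (`|Λ_{m+1}| = (2m+3)³`, `|E(Λ_{m+1})| ≤ 6 |Λ_{m+1}|`,
three directions; no boundary-pair factor). [cite: Cerf2015, Lemma 7.1] -/
theorem real_pair_le_poly (p : unitInterval) (hp0 : 0 < (p : ℝ)) {C κ δ : ℝ}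
    (hδ : 0 < δ) (hC : ∀ i : Fin 3, ∀ m : ℕ, 1 ≤ m →
      (bondPercolation (zdGraph 3) p).real (AKN.edgeTwoArms i m) ≤ C * (m : ℝ) ^ (-κ))
    {n m M : ℕ} (hnm : n ≤ m) (hmM : m + 3 ≤ M) {x x' : Site 3} (hx : x ∈ box 3 n)
    (hx' : x' ∈ box 3 n)
    (hq : δ ≤ (bondPercolation (zdGraph 3) p).real (openConnIn (↑(box 3 m) : Set (Site 3)) x x')) :
    (bondPercolation (zdGraph 3) p).real
      {ω | ∃ y ∈ innerBoundary (zdGraph 3) (box 3 M),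
        ∃ y' ∈ innerBoundary (zdGraph 3) (box 3 M),
          ω ∈ openConnIn ↑(box 3 M) x y ∧ ω ∈ openConnIn ↑(box 3 M) x' y' ∧
          ω ∉ openConnIn ↑(box 3 M) x x'} ≤
      (1 + 6 / (p : ℝ)) * (2 * (m : ℝ) + 3) ^ 6 * (3 * C * ((M : ℝ) - m - 2) ^ (-κ)) / δ := by
  set μ := bondPercolation (zdGraph 3) p with hμ
  obtain ⟨k, hk⟩ : ∃ k, m = n + k := ⟨m - n, by omega⟩
  obtain ⟨ℓ, hℓ⟩ : ∃ ℓ, M = n + ℓ := ⟨M - n, by omega⟩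
  have hkℓ : k + 3 ≤ ℓ := by omega
  have hj1 : 1 ≤ ℓ - k - 2 := by omega
  have hcast : (((ℓ - k - 2 : ℕ)) : ℝ) = (M : ℝ) - m - 2 := by
    have h : ℓ - k - 2 + m + 2 = M := by omega
    have h' : (((ℓ - k - 2 : ℕ)) : ℝ) + m + 2 = M := by exact_mod_cast h
    linarith
  obtain ⟨t, ht⟩ : ∃ t : ℝ, t = (M : ℝ) - m - 2 := ⟨_, rfl⟩
  rw [← ht] at hcast ⊢
  obtain ⟨B, hB⟩ : ∃ B : ℝ, B = 2 * (m : ℝ) + 3 := ⟨_, rfl⟩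
  rw [← hB]
  have hB1 : 1 ≤ B := by rw [hB]; linarith [(Nat.cast_nonneg m : (0 : ℝ) ≤ m)]
  have hB0 : 0 ≤ B := by linarith
  subst hk
  subst hℓ
  have hA := real_pair_le_of_conn p hp0 hkℓ hδ hx hx' hq
  refine hA.trans (div_le_div_of_nonneg_right ?_ hδ.le)
  have hcard2 : ((box 3 (n + k + 1)).card : ℝ) = B ^ 3 := by
    rw [card_box, hB]; push_cast; ring
  have hE : ((edgesIn (zdGraph 3) (box 3 (n + k + 1))).card : ℝ) ≤ 6 * B ^ 3 := by
    have h := AKN.card_edgesIn_le (d := 3) (box 3 (n + k + 1))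
    have h' : ((edgesIn (zdGraph 3) (box 3 (n + k + 1))).card : ℝ) ≤
        2 * 3 * ((box 3 (n + k + 1)).card : ℝ) := by exact_mod_cast h
    rw [hcard2] at h'
    linarith
  have hS0 : 0 ≤ ∑ i : Fin 3, μ.real (AKN.edgeTwoArms i (ℓ - k - 2)) :=
    Finset.sum_nonneg fun _ _ => measureReal_nonneg
  have hS : ∑ i : Fin 3, μ.real (AKN.edgeTwoArms i (ℓ - k - 2)) ≤ 3 * C * t ^ (-κ) := by
    rw [← hcast]
    calc ∑ i : Fin 3, μ.real (AKN.edgeTwoArms i (ℓ - k - 2))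
        ≤ ∑ _i : Fin 3, C * (((ℓ - k - 2 : ℕ)) : ℝ) ^ (-κ) :=
          Finset.sum_le_sum fun i _ => hC i _ hj1
      _ = 3 * C * (((ℓ - k - 2 : ℕ)) : ℝ) ^ (-κ) := by
          rw [Finset.sum_const, Finset.card_univ, Fintype.card_fin, nsmul_eq_mul]; push_cast; ring
  have h1 : 1 + ((edgesIn (zdGraph 3) (box 3 (n + k + 1))).card : ℝ) / p ≤
      (1 + 6 / (p : ℝ)) * B ^ 3 := by
    have h2 : ((edgesIn (zdGraph 3) (box 3 (n + k + 1))).card : ℝ) / p ≤ 6 * B ^ 3 / p :=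
      div_le_div_of_nonneg_right hE hp0.le
    have hB3 : 1 ≤ B ^ 3 := one_le_pow₀ hB1
    calc 1 + ((edgesIn (zdGraph 3) (box 3 (n + k + 1))).card : ℝ) / p ≤ 1 + 6 * B ^ 3 / p := by
          linarith
      _ ≤ B ^ 3 + 6 * B ^ 3 / p := by linarith
      _ = (1 + 6 / (p : ℝ)) * B ^ 3 := by ring
  rw [hcard2]
  calc (1 + ((edgesIn (zdGraph 3) (box 3 (n + k + 1))).card : ℝ) / p) *
        (B ^ 3 * ∑ i : Fin 3, μ.real (AKN.edgeTwoArms i (ℓ - k - 2)))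
      ≤ ((1 + 6 / (p : ℝ)) * B ^ 3) * (B ^ 3 * (3 * C * t ^ (-κ))) :=
        mul_le_mul h1 (mul_le_mul_of_nonneg_left hS (by positivity)) (mul_nonneg (by positivity) hS0)
          (by positivity)
    _ = (1 + 6 / (p : ℝ)) * B ^ 6 * (3 * C * t ^ (-κ)) := by ring

/-! ## Real analysis -/

/-- **The polynomial count against the scales** (fixed-pair version). For
`1 ≤ P ≤ mr ≤ P + 1`, `Q ≤ Mr`, `8P ≤ Q`, `q, C ≥ 0`, `δ > 0`, `κ ≥ 0`:
`q (2 mr + 3)⁶ · 3C (Mr − mr − 2)^{−κ} / δ ≤ (7⁶ · 3 · 2^κ q C / δ) · P⁶ Q^{−κ}`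
(`2mr+3 ≤ 7P`, `Mr − mr − 2 ≥ Q/2`). [folklore] -/
theorem poly_bound_pair {P Q mr Mr q C δ κ : ℝ} (hP1 : 1 ≤ P) (hm1 : P ≤ mr)
    (hm2 : mr ≤ P + 1) (hM1 : Q ≤ Mr) (h8 : 8 * P ≤ Q) (hq : 0 ≤ q) (hC : 0 ≤ C) (hδ : 0 < δ)
    (hκ : 0 ≤ κ) :
    q * (2 * mr + 3) ^ 6 * (3 * C * (Mr - mr - 2) ^ (-κ)) / δ ≤
      7 ^ 6 * 3 * 2 ^ κ * q * C / δ * (P ^ (6 : ℕ) * Q ^ (-κ)) := by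
  have hQ2 : 0 < Q / 2 := by linarith
  have ht : Q / 2 ≤ Mr - mr - 2 := by linarith
  have h2 : (2 * mr + 3) ^ 6 ≤ (7 * P) ^ 6 := pow_le_pow_left₀ (by linarith) (by linarith) 6
  have h3 : (Mr - mr - 2) ^ (-κ) ≤ (Q / 2) ^ (-κ) := Real.rpow_le_rpow_of_nonpos hQ2 ht (by linarith)
  have h4 : (Q / 2) ^ (-κ) = 2 ^ κ * Q ^ (-κ) := by
    rw [Real.div_rpow (by linarith) (by norm_num), Real.rpow_neg (by norm_num : (0 : ℝ) ≤ 2) κ,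
      div_inv_eq_mul, mul_comm]
  have h0 : 0 ≤ (Mr - mr - 2) ^ (-κ) := Real.rpow_nonneg (by linarith) _
  have hmr0 : 0 ≤ 2 * mr + 3 := by linarith
  have h3C : 0 ≤ 3 * C * (Mr - mr - 2) ^ (-κ) := mul_nonneg (mul_nonneg (by norm_num) hC) h0
  have hX : q * (2 * mr + 3) ^ 6 * (3 * C * (Mr - mr - 2) ^ (-κ)) ≤
      q * (7 * P) ^ 6 * (3 * C * (Q / 2) ^ (-κ)) :=
    mul_le_mul (mul_le_mul_of_nonneg_left h2 hq)
      (mul_le_mul_of_nonneg_left h3 (mul_nonneg (by norm_num) hC)) h3C (by positivity)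
  calc q * (2 * mr + 3) ^ 6 * (3 * C * (Mr - mr - 2) ^ (-κ)) / δ
      ≤ q * (7 * P) ^ 6 * (3 * C * (Q / 2) ^ (-κ)) / δ := div_le_div_of_nonneg_right hX hδ.le
    _ = 7 ^ 6 * 3 * 2 ^ κ * q * C / δ * (P ^ (6 : ℕ) * Q ^ (-κ)) := by rw [h4]; ring

/-- **Collecting the powers** against the pair-connection lower bound `δ = c t^{-e}`:
`(7⁶ · 3 · 2^κ q C / (c t^{−e})) · (2t)⁶ (t^A)^{−κ} = (7⁶ · 3 · 2^κ q C 2⁶ / c) · t^{6 + e − κA}`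
for `t > 0`. [folklore] -/
theorem collect_rpow_pair {t c e κ A q C : ℝ} (ht : 0 < t) :
    7 ^ 6 * 3 * 2 ^ κ * q * C / (c * t ^ (-e)) * ((2 * t) ^ (6 : ℕ) * (t ^ A) ^ (-κ)) =
      7 ^ 6 * 3 * 2 ^ κ * q * C * 2 ^ 6 / c * t ^ (6 + e - κ * A) := by
  have e1 : t ^ (-e) = (t ^ e)⁻¹ := Real.rpow_neg ht.le e
  have e2 : (t ^ A) ^ (-κ) = t ^ (-(κ * A)) := by
    rw [← Real.rpow_mul ht.le]; congr 1; ring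
  have e3 : t ^ (6 + e - κ * A) = t ^ (6 : ℕ) * t ^ e * t ^ (-(κ * A)) := by
    rw [sub_eq_add_neg, Real.rpow_add ht, Real.rpow_add ht]
    congr 2
    exact_mod_cast Real.rpow_natCast t 6
  rw [e1, e2, e3]
  simp only [div_eq_mul_inv, mul_inv, inv_inv]
  ring

end NearLinearTwoClusterDecayPairAspect

open MeasureTheory Filter Topology
open Literature.Probability.LatticeModels Literature.Probability.Percolation
open NearLinearTwoClusterDecayPairAspect NearLinearTwoClusterDecayCritAspect

/-- **Frontier stub F1 `stub_pairAspectOfTwoArm` of the line `pair-decay-long-arms-dense`**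
(registered; § Unconditional frontier, the PAIR-form lossy step at a general parameter): for bond
percolation on `ℤ³` at any `p > 0`, a pair-connection lower bound `P_p(a ↔ b inside Λ_{2n}) ≥ c n^{-e}`
on `Λ_n²` (`e ≥ 0`) and a two-arms exponent `κ` give, at every aspect exponent `A > 1` with
`κ A > 6 + e` and every `ε > 0`, eventually in `n` and uniformly over the FIXED pair `x, x' ∈ Λ_n`,
that the pair event of `(Λ_n, Λ_N)`, `N = ⌈n^A⌉₊` (both sites joined inside `Λ_N` to `∂ⁱⁿΛ_N`, not to
each other inside `Λ_N`) has probability `≤ ε` — on lattice configurations it forces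
`twoArmsBox n (N − n) x x'`, then Cerf 2015 Lemma 7.1 (bond, `AKN.real_twoArmsBox_mul_le`) with middle
box `Λ_{2n}` divided by `δ = c n^{-e}` and the count
`(1 + 6/p)(4n+3)⁶ · 3C (N − 2n − 2)^{−κ} / (c n^{−e}) ≤ K n^{6 + e − κA} → 0` (no pair sum).
[cite: Cerf2015, Lemma 7.1] -/
theorem stub_pairAspectOfTwoArm :
    ∀ p : unitInterval, 0 < (p : ℝ) → ∀ e : ℝ, 0 ≤ e →
    (∃ c : ℝ, 0 < c ∧ ∀ n : ℕ, 1 ≤ n → ∀ a ∈ box 3 n, ∀ b ∈ box 3 n,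
      c * (n : ℝ) ^ (-e) ≤
        (bondPercolation (zdGraph 3) p).real (openConnIn (↑(box 3 (2 * n)) : Set (Site 3)) a b)) →
    ∀ κ : ℝ, 0 < κ →
    (∃ C : ℝ, ∀ i : Fin 3, ∀ m : ℕ, 1 ≤ m →
      (bondPercolation (zdGraph 3) p).real (AKN.edgeTwoArms i m) ≤ C * (m : ℝ) ^ (-κ)) →
    ∀ A : ℝ, 1 < A → 6 + e < κ * A →
    ∀ ε : ℝ, 0 < ε → ∀ᶠ n : ℕ in Filter.atTop, ∀ x ∈ box 3 n, ∀ x' ∈ box 3 n,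
      (bondPercolation (zdGraph 3) p).real
        {ω | ∃ y ∈ innerBoundary (zdGraph 3) (box 3 ⌈(n : ℝ) ^ A⌉₊),
          ∃ y' ∈ innerBoundary (zdGraph 3) (box 3 ⌈(n : ℝ) ^ A⌉₊),
            ω ∈ openConnIn ↑(box 3 ⌈(n : ℝ) ^ A⌉₊) x y ∧
            ω ∈ openConnIn ↑(box 3 ⌈(n : ℝ) ^ A⌉₊) x' y' ∧
            ω ∉ openConnIn ↑(box 3 ⌈(n : ℝ) ^ A⌉₊) x x'} ≤ ε := by
  intro p hp0 e _he hW1 κ hκ hTA A hA1 hκA ε hε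
  obtain ⟨c, hc, hW⟩ := hW1
  obtain ⟨C, hC⟩ := hTA
  have hC0 : 0 ≤ C := by
    have h := hC 0 1 le_rfl
    rw [Nat.cast_one, Real.one_rpow, mul_one] at h
    exact measureReal_nonneg.trans h
  obtain ⟨q, hq⟩ : ∃ q : ℝ, q = 1 + 6 / (p : ℝ) := ⟨_, rfl⟩
  have hq0 : 0 ≤ q := by rw [hq]; positivity
  obtain ⟨K, hK⟩ : ∃ K : ℝ, K = 7 ^ 6 * 3 * 2 ^ κ * q * C * 2 ^ 6 / c := ⟨_, rfl⟩
  have hlim : Tendsto (fun n : ℕ => K * (n : ℝ) ^ (6 + e - κ * A)) atTop (𝓝 0) := by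
    have h1 : Tendsto (fun n : ℕ => (n : ℝ) ^ (6 + e - κ * A)) atTop (𝓝 0) := by
      have e' : 6 + e - κ * A = -(κ * A - 6 - e) := by ring
      rw [e']
      exact (tendsto_rpow_neg_atTop (by linarith)).comp tendsto_natCast_atTop_atTop
    simpa only [mul_zero] using h1.const_mul K
  have hevε : ∀ᶠ n : ℕ in atTop, K * (n : ℝ) ^ (6 + e - κ * A) < ε := (tendsto_order.1 hlim).2 ε hε
  -- at a good scale `n` (`1 ≤ n`, `16 n ≤ n^A ≤ N`, W3's `eventually_one_le_and_sixteen_mul_le`)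
  filter_upwards [eventually_one_le_and_sixteen_mul_le hA1, hevε] with n ⟨hn1, h16⟩ hnε x hx x' hx'
  have hU1 : (1 : ℝ) ≤ n := Nat.one_le_cast.2 hn1
  have hU0 : (0 : ℝ) < n := by linarith
  have hδ : 0 < c * (n : ℝ) ^ (-e) := mul_pos hc (Real.rpow_pos_of_pos hU0 _)
  have hmr : ((2 * n : ℕ) : ℝ) = 2 * (n : ℝ) := by push_cast; ring
  have hM1 : (n : ℝ) ^ A ≤ (⌈(n : ℝ) ^ A⌉₊ : ℕ) := Nat.le_ceil _
  have hmM : 2 * n + 3 ≤ ⌈(n : ℝ) ^ A⌉₊ := by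
    have h : ((2 * n : ℕ) : ℝ) + 3 ≤ (⌈(n : ℝ) ^ A⌉₊ : ℕ) := by rw [hmr]; linarith
    exact_mod_cast h
  refine le_trans ?_ hnε.le
  calc (bondPercolation (zdGraph 3) p).real
        {ω | ∃ y ∈ innerBoundary (zdGraph 3) (box 3 ⌈(n : ℝ) ^ A⌉₊),
          ∃ y' ∈ innerBoundary (zdGraph 3) (box 3 ⌈(n : ℝ) ^ A⌉₊),
            ω ∈ openConnIn ↑(box 3 ⌈(n : ℝ) ^ A⌉₊) x y ∧
            ω ∈ openConnIn ↑(box 3 ⌈(n : ℝ) ^ A⌉₊) x' y' ∧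
            ω ∉ openConnIn ↑(box 3 ⌈(n : ℝ) ^ A⌉₊) x x'}
      ≤ (1 + 6 / (p : ℝ)) * (2 * ((2 * n : ℕ) : ℝ) + 3) ^ 6 *
            (3 * C * (((⌈(n : ℝ) ^ A⌉₊ : ℕ) : ℝ) - ((2 * n : ℕ) : ℝ) - 2) ^ (-κ)) /
          (c * (n : ℝ) ^ (-e)) :=
        real_pair_le_poly p hp0 hδ hC (by omega) hmM hx hx' (hW n hn1 x hx x' hx')
    _ ≤ 7 ^ 6 * 3 * 2 ^ κ * q * C / (c * (n : ℝ) ^ (-e)) *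
          ((2 * (n : ℝ)) ^ (6 : ℕ) * ((n : ℝ) ^ A) ^ (-κ)) := by
        rw [hq]
        exact poly_bound_pair (by linarith) hmr.ge (by rw [hmr]; linarith) hM1 (by linarith)
          (hq ▸ hq0) hC0 hδ hκ.le
    _ = K * (n : ℝ) ^ (6 + e - κ * A) := by rw [hK]; exact collect_rpow_pair hU0

end Summit.CriticalPhenomena.PercolationContinuityZ3.Theorems
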